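import Literature.Analysis.OperatorTheory.Enflo2023.CaseIIMinimal
import Literature.Analysis.OperatorTheory.Enflo2023.RoomClaimT
import Literature.Analysis.OperatorTheory.Enflo2023.TypeDichotomy
import HarnessLib

/-!
# Enflo 2023, v2 eq. (27) WITH THE OPERATOR IN IT: (27) fails for the minimiser of (26) under every standing hypothesis on `T`

Source under adjudication: Per H. Enflo, *On the invariant subspace problem in Hilbert spaces*, arXiv:2305.15442 (v1
2023, v2 2024), bib key `Enflo2023` — a CLAIMED proof of the invariant subspace problem for operators on a separable
Hilbert space.  This file is part of the kernel-tight typing of the manuscript by the b2b-enflo repair cell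
(formaliser 1, Part A: v2 eq. (1)–(27), the set-up, the constructions `V_y`, `ℓ'`, `[ ]x₀`, Lemma 1 and Case I/II of
the main step).  It records what FOLLOWS (proved implications from the manuscript's displayed hypotheses) and, where a
step does not follow, the typed inference together with its refutation.  NOTHING here asserts that the manuscript's
main theorem holds; no declaration concludes the invariant subspace problem for an arbitrary operator.  Value
(BLOCK-2b): theorems / refutations of typed inferences about a text — not progress on the problem.

WHAT THIS FILE ADDS.  `CaseII.eq27_false_for_minimal` (`CaseIIMinimal.lean`) refutes (27) for THE norm-minimal `ℓ'`
of (26) for any bounded `T` with `‖T‖ ≤ 10⁻²⁰` whose data `(x₀, y, Ty)` lie in the window; its model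
(`minimal_window_satisfiable`) is a rank-one `T` on `ℂ³` — not injective, finite-dimensional.  The manuscript's `T`
carries STANDING HYPOTHESES (v2 pp.1–2, tex:L61 / L221): `H` separable infinite-dimensional, `T` injective, `R(T) ≠ H`,
`R(T)` dense, `0 ∈ σ(T)`, `‖T‖_op = 10⁻²⁰`; and at p.13 `T` is "of Type 1" (v2 p.6) with the vectors `y` in the Type-1
cone `⟨y/‖y‖, u₀⟩ ≥ 1/100`.  As formaliser 2 did for the p.20 room claim (`RoomClaimT.lean`), the honest test of "does a
hypothesis ON THE OPERATOR repair (27)?" is the inference with the operator written into it: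
  * `Eq27Inference` — every standing hypothesis above + Type 1 via `u₀` with `y` in the cone + the data of (26)
    (`‖x₀‖ = 1`, `⟨y, x₀ − y⟩ = εθ ∈ (0, 10⁻²³]`, `0.3 ≤ ‖x₀ − y‖ ≤ 0.7`) + Case II AS PRINTED, for ALL `j ≥ 1` and
    strict: `|⟨T^j y, x₀ − y⟩| < (εθ)⁴` (tex:L400) + `a ∈ ℓ²` THE norm-minimal solution of (1) for `V_y` at the radius
    `‖x₀ − (1+δ)y‖`, `δ = εθ/10` (eq. (26))  ⟹  (27): `‖V_y a − (1+δ)y‖ < (εθ)²`;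
  * `Eq27InferenceSA` — the same PLUS `T` self-adjoint (the strongest class of the repair census: self-adjoint ⊂
    normal ⊂ essentially normal; the THEOREM (ISP) is classical for these classes, the question is the MECHANISM).
VERDICT: `not_eq27InferenceSA`, hence `not_eq27Inference`.  Witness (`CaseII.ModelT`) on `ℓ²(ℕ)` with formaliser
2's diagonal operator `D` (`RoomClaimT.lean`: weights `10⁻²⁰` on `e₀,…,e₃`, `10⁻²⁰/(k+1)` beyond; self-adjoint,
injective, dense non-closed range, `0 ∈ σ(D)`, `‖D‖ = 10⁻²⁰`), which is moreover of Type 1 via `u₀ = e₀` with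
`δ_n = 10^{-20n}/10⁴` (`D_type1`), and the following EXPLICIT data on the eigenvectors `e₀, e₄, e₅, e₆, e₁` of `D`
(eigenvalues `λ(1, 1/5, 1/6, 1/7, 1)`, `λ = 10⁻²⁰`), for every `εθ ∈ [10⁻²⁶, 10⁻²³]`:
    `y  = (3/5)e₀ + (1/2)e₄ + (2/5)e₅ + (3/10)e₆`                       (`‖y‖² = 43/50`, `Re⟨e₀, y⟩ = 3/5 ≥ ‖y‖/100`),
    `x₀ = y + εθ(−e₀/72 + (125/4)e₄ − 108e₅ + (1715/18)e₆) + s·e₁`,   `s = (7/50 − 2εθ − γ(εθ)²)^{1/2}`, `γ = 112588277/5184`,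
so that `‖x₀‖ = 1` and `⟨y, x₀ − y⟩ = εθ` EXACTLY, `‖x₀ − y‖² = 7/50 − 2εθ` (`≈ 0.374²`, inside Lemma 1's
`(0.3, 0.5]`), `⟨y, Dy⟩ = (236/525)λ ≥ 10⁻²¹`, `dist(Dy, ℂy) = 0.376λ ≥ 10⁻²¹`, and — the point of the design — the
coefficients `c = (−1/120, 125/8, −216/5, 343/12)` are the Lagrange weights of the nodes `(1, 1/5, 1/6, 1/7)` at `0`
(`Σcᵢ = 1`, `Σcᵢrᵢ^j = 0` for `j = 1, 2, 3`), so `⟨D^j y, x₀ − y⟩ = εθ·λ^j·Σcᵢrᵢ^j` VANISHES for `j = 1, 2, 3` and is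
`≤ (1049/12)·10⁻⁸⁰·εθ < (εθ)⁴` for `j ≥ 4`: Case II holds for EVERY `j ≥ 1`, strictly, as the manuscript states it.
Problem (1) for `V_y` at `ε' = ‖x₀ − (1+δ)y‖ < 1` has a minimal solution (`(1+δ)e₀` is feasible, `ℓ²` complete), and
`eq27_false_for_minimal` fires on it: the minimal move is `≥ (εθ)²`, contradicting (27) (`ModelT.facts`,
`minimal_window_satisfiable_T`).  So: NO hypothesis of spectral type on `T`, and none of the manuscript's standing
hypotheses, enters or repairs the p.13 inference (repair census, GAP.md §F1: the (27) row now reads like R9/R10/R13).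
NOT MODELLED (and not used by the text's justification of (27), tex:L410–416): cyclicity of `y` (in the model `y` is
not cyclic — `D` has the eigenvalue `10⁻²⁰` with multiplicity 4, so it has no cyclic vector; the same holds for the
`RoomClaimT` witness), the Type-1 form `x₀ = (√3/2)u₀ + ½u₁` of `x₀` (v2 p.7), and `y` being an actual iterate of the
Main Construction.  The failure of (27) is decided by the first two coordinates of `ℓ'` at scales `≥ 10⁻⁴²`
(`CaseII.lean`), five orders above `(εθ)²`.
Conventions: Mathlib's `⟪u, v⟫_ℂ` is conjugate-linear in `u`; the paper's `⟨u, v⟩` is `⟪v, u⟫_ℂ`; `T^j x` is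
`(T ^ j) x` (operator power) except inside the Type-1 clause, which follows `TypeDichotomy.lean`'s `(⇑T)^[j] x`.
STATUS: CLOSED (zero sorry); axioms `[propext, Classical.choice, Quot.sound]`.
Origin: planner-b2b-enflo-1-g3-0 (formaliser 1, gen 3), 2026-08-18.
-/

open scoped InnerProductSpace ENNReal
open Literature.Analysis.UnboundedOperators (inner_self_eq_coe_norm_sq)

noncomputable section

namespace Literature.Analysis.OperatorTheory.Enflo2023

/-! ### (1) The inference at (27) with the operator in it, typed -/

/-- v2 p.13, (26) ⟹ (27), typed WITH THE OPERATOR AND ITS STANDING HYPOTHESES: `H` a separable infinite-dimensional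
Hilbert space; `T` injective, not surjective, with dense range, `0 ∈ σ(T)`, `‖T‖ = 10⁻²⁰` (v2 pp.1–2); `T` of Type 1
via the unit vector `u₀` (v2 p.6: for every `n ≥ 1` a `δ_n > 0` with `|⟨T^j y', y'⟩| ≥ δ_n‖y'‖²` for some `j ≥ n`,
for every `y'` in the cone `⟨y'/‖y'‖, u₀⟩ ≥ 1/100`) and `y` in that cone; `‖x₀‖ = 1`, `⟨y, x₀ − y⟩ = εθ ∈ (0, 10⁻²³]`,
`0.3 ≤ ‖x₀ − y‖ ≤ 0.7`; Case II for all `j ≥ 1`: `|⟨T^j y, x₀ − y⟩| < (εθ)⁴`; `a` THE norm-minimal solution of (1)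
for `V_y` at radius `‖x₀ − (1+δ)y‖`, `δ = εθ/10` (26).  Conclusion as printed, (27): `‖V_y a − (1+δ)y‖ < (εθ)²`.
Refuted below (`not_eq27Inference`). [cite: Enflo2023, v2 p.13, eq. (26)–(27); pp.1–2; p.6] -/
@[claim "Enflo2023" "disputed"]
def Eq27Inference : Prop :=
  ∀ (H : Type) [NormedAddCommGroup H] [InnerProductSpace ℂ H] [CompleteSpace H]
    [TopologicalSpace.SeparableSpace H], ¬ FiniteDimensional ℂ H →
  ∀ (T : H →L[ℂ] H) (hT1 : ‖T‖ < 1) (u₀ x₀ y : H) (et : ℝ) (a : Vy.ℓ2),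
    Function.Injective T → ¬ Function.Surjective T → DenseRange T → (0 : ℂ) ∈ spectrum ℂ T →
    ‖T‖ = 1 / 10 ^ 20 →
    ‖u₀‖ = 1 →
    (∀ n : ℕ, 1 ≤ n → ∃ δ : ℝ, 0 < δ ∧ ∀ y' : H, Referee.AngleCond u₀ y' →
        ∃ j : ℕ, n ≤ j ∧ δ * ‖y'‖ ^ 2 ≤ ‖⟪(⇑T)^[j] y', y'⟫_ℂ‖) →
    Referee.AngleCond u₀ y →
    ‖x₀‖ = 1 → ⟪x₀ - y, y⟫_ℂ = (et : ℂ) → 0 < et → et ≤ 1 / 10 ^ 23 →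
    (0.3 : ℝ) ≤ ‖x₀ - y‖ → ‖x₀ - y‖ ≤ 0.7 →
    (∀ j : ℕ, 1 ≤ j → ‖⟪x₀ - y, (T ^ j) y⟫_ℂ‖ < et ^ 4) →
    IsMinimal (Vy.V T hT1 y) x₀ ‖x₀ - ((1 + et / 10 : ℝ) : ℂ) • y‖ a →
    ‖Vy.V T hT1 y a - ((1 + et / 10 : ℝ) : ℂ) • y‖ < et ^ 2

/-- The same inference with, IN ADDITION, `T` self-adjoint — the strongest hypothesis of spectral type in the repair
census (self-adjoint ⊂ normal ⊂ essentially normal).  Refuted below (`not_eq27InferenceSA`). [cite: Enflo2023, v2 p.13, eq. (26)–(27); pp.1–2; p.6] -/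
@[claim "Enflo2023" "disputed"]
def Eq27InferenceSA : Prop :=
  ∀ (H : Type) [NormedAddCommGroup H] [InnerProductSpace ℂ H] [CompleteSpace H]
    [TopologicalSpace.SeparableSpace H], ¬ FiniteDimensional ℂ H →
  ∀ (T : H →L[ℂ] H) (hT1 : ‖T‖ < 1) (u₀ x₀ y : H) (et : ℝ) (a : Vy.ℓ2),
    Function.Injective T → ¬ Function.Surjective T → DenseRange T → (0 : ℂ) ∈ spectrum ℂ T →
    ‖T‖ = 1 / 10 ^ 20 → IsSelfAdjoint T →
    ‖u₀‖ = 1 →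
    (∀ n : ℕ, 1 ≤ n → ∃ δ : ℝ, 0 < δ ∧ ∀ y' : H, Referee.AngleCond u₀ y' →
        ∃ j : ℕ, n ≤ j ∧ δ * ‖y'‖ ^ 2 ≤ ‖⟪(⇑T)^[j] y', y'⟫_ℂ‖) →
    Referee.AngleCond u₀ y →
    ‖x₀‖ = 1 → ⟪x₀ - y, y⟫_ℂ = (et : ℂ) → 0 < et → et ≤ 1 / 10 ^ 23 →
    (0.3 : ℝ) ≤ ‖x₀ - y‖ → ‖x₀ - y‖ ≤ 0.7 →
    (∀ j : ℕ, 1 ≤ j → ‖⟪x₀ - y, (T ^ j) y⟫_ℂ‖ < et ^ 4) →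
    IsMinimal (Vy.V T hT1 y) x₀ ‖x₀ - ((1 + et / 10 : ℝ) : ℂ) • y‖ a →
    ‖Vy.V T hT1 y a - ((1 + et / 10 : ℝ) : ℂ) • y‖ < et ^ 2

/-- Adding the hypothesis `IsSelfAdjoint T` only weakens the claim: `Eq27Inference → Eq27InferenceSA` (so refuting
the latter refutes the former). [cite: Enflo2023, v2 p.13, eq. (26)–(27)] -/
theorem eq27InferenceSA_of_eq27Inference (h : Eq27Inference) : Eq27InferenceSA := by
  intro H _ _ _ _ hinf T hT1 u₀ x₀ y et a hinj hsurj hdense hspec hnorm _ hu₀ htype hang h0 hey het0 het2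
    hρ1 hρ2 hcase hmin
  exact h H hinf T hT1 u₀ x₀ y et a hinj hsurj hdense hspec hnorm hu₀ htype hang h0 hey het0 het2 hρ1 hρ2 hcase hmin

/-! ### (2) The model data on an orthonormal 5-frame of eigenvectors (any complex inner-product space) -/

namespace CaseII

namespace WindowModelT

/-- `λ = 10⁻²⁰ = ‖T‖_op` (v2 p.12: `K = 10²⁰`). [cite: Enflo2023, v2 p.12] -/
def lam : ℝ := 1 / 10 ^ 20

/-- Unfolding `λ`. [cite: Enflo2023, v2 p.12] -/
lemma lam_def : lam = 1 / 10 ^ 20 := rfl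

/-- The eigenvalues of `T` on the frame: `λ·(1, 1/5, 1/6, 1/7, 1)`. [cite: Enflo2023, v2 p.13, eq. (27)] -/
def mu : Fin 5 → ℝ := ![lam, lam / 5, lam / 6, lam / 7, lam]

/-- The coefficients of `y = (3/5)e₀ + (1/2)e₁ + (2/5)e₂ + (3/10)e₃` (frame numbering). [cite: Enflo2023, v2 p.13, eq. (27)] -/
def yc : Fin 5 → ℝ := ![3 / 5, 1 / 2, 2 / 5, 3 / 10, 0]

/-- The radicand of the bulk coordinate: `1 − Σ_{i<4}(yᵢ + uᵢ)²`. [cite: Enflo2023, v2 p.13, eq. (27)] -/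
def radicand (et : ℝ) : ℝ :=
  1 - ((3 / 5 - et / 72) ^ 2 + (1 / 2 + 125 * et / 4) ^ 2 + (2 / 5 - 108 * et) ^ 2 + (3 / 10 + 1715 * et / 18) ^ 2)

/-- The bulk coordinate `s = (1 − Σ_{i<4}(yᵢ + uᵢ)²)^{1/2}` (it makes `‖x₀‖ = 1` exact). [cite: Enflo2023, v2 p.13, eq. (27)] -/
def s (et : ℝ) : ℝ := Real.sqrt (radicand et)

/-- The coefficients of `u = x₀ − y = εθ(cᵢ/yᵢ)ᵢ + s e₄`, `c = (−1/120, 125/8, −216/5, 343/12)` the Lagrange weights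
of the nodes `(1, 1/5, 1/6, 1/7)` at `0`. [cite: Enflo2023, v2 p.13, eq. (27)] -/
def uc (et : ℝ) : Fin 5 → ℝ := ![-(et / 72), 125 * et / 4, -(108 * et), 1715 * et / 18, s et]

/-- The coefficients of `x₀ = y + u`. [cite: Enflo2023, v2 p.13, eq. (27)] -/
def x0c (et : ℝ) : Fin 5 → ℝ :=
  ![3 / 5 - et / 72, 1 / 2 + 125 * et / 4, 2 / 5 - 108 * et, 3 / 10 + 1715 * et / 18, s et]

/-- The radicand as a polynomial: `7/50 − 2εθ − γ(εθ)²`, `γ = 112588277/5184 ≈ 2.2·10⁴`. [cite: Enflo2023, v2 p.13, eq. (27)] -/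
lemma radicand_eq (et : ℝ) : radicand et = 7 / 50 - 2 * et - 112588277 / 5184 * et ^ 2 := by
  unfold radicand; ring

/-- The radicand is positive for `0 < εθ ≤ 10⁻²³`. [cite: Enflo2023, v2 p.13, eq. (27)] -/
lemma radicand_pos {et : ℝ} (het0 : 0 < et) (het2 : et ≤ 1 / 10 ^ 23) : 0 < radicand et := by
  rw [radicand_eq]
  have h2 : et ^ 2 ≤ (1 / 10 ^ 23) ^ 2 := pow_le_pow_left₀ het0.le het2 2
  nlinarith

/-- `s² = radicand`. [cite: Enflo2023, v2 p.13, eq. (27)] -/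
lemma s_sq {et : ℝ} (het0 : 0 < et) (het2 : et ≤ 1 / 10 ^ 23) : s et ^ 2 = radicand et :=
  Real.sq_sqrt (radicand_pos het0 het2).le

/-- `x₀ = y + u` coordinatewise. [cite: Enflo2023, v2 p.13, eq. (27)] -/
lemma x0c_eq (et : ℝ) (i : Fin 5) : x0c et i = yc i + uc et i := by
  fin_cases i <;> simp [x0c, yc, uc] <;> ring

/-- The Case II bracket `Σᵢ cᵢ μᵢ^j` VANISHES for `j = 1, 2, 3` (Lagrange weights). [cite: Enflo2023, v2 p.13, Case II] -/
lemma bracket_zero_of_le_three (j : ℕ) (hj1 : 1 ≤ j) (hj3 : j ≤ 3) :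
    (-(1 / 120) * lam ^ j + 125 / 8 * (lam / 5) ^ j - 216 / 5 * (lam / 6) ^ j + 343 / 12 * (lam / 7) ^ j : ℝ)
      = 0 := by
  interval_cases j <;> ring

/-- The Case II bracket is `≤ (Σ|cᵢ|)λ⁴ = (1049/12)λ⁴` in absolute value for `j ≥ 4`. [cite: Enflo2023, v2 p.13, Case II] -/
lemma bracket_abs_le (j : ℕ) (hj : 4 ≤ j) :
    |(-(1 / 120) * lam ^ j + 125 / 8 * (lam / 5) ^ j - 216 / 5 * (lam / 6) ^ j + 343 / 12 * (lam / 7) ^ j : ℝ)|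
      ≤ 1049 / 12 * lam ^ 4 := by
  have hl0 : 0 ≤ lam := by rw [lam_def]; norm_num
  have hl1 : lam ≤ 1 := by rw [lam_def]; norm_num
  have h4 : lam ^ j ≤ lam ^ 4 := pow_le_pow_of_le_one hl0 hl1 hj
  have hp : ∀ c : ℝ, 1 ≤ c → 0 ≤ (lam / c) ^ j ∧ (lam / c) ^ j ≤ lam ^ 4 := by
    intro c hc
    have h0 : 0 ≤ lam / c := div_nonneg hl0 (by linarith)
    have h1 : lam / c ≤ lam := div_le_self hl0 hc
    exact ⟨pow_nonneg h0 j, (pow_le_pow_left₀ h0 h1 j).trans h4⟩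
  obtain ⟨h50, h51⟩ := hp 5 (by norm_num)
  obtain ⟨h60, h61⟩ := hp 6 (by norm_num)
  obtain ⟨h70, h71⟩ := hp 7 (by norm_num)
  have h10 : 0 ≤ lam ^ j := pow_nonneg hl0 j
  rw [abs_le]; constructor <;> nlinarith

variable {H : Type*} [NormedAddCommGroup H] [InnerProductSpace ℂ H]

/-- Real combinations of the frame: `Σᵢ aᵢ eᵢ`. [folklore] -/
def vec (e : Fin 5 → H) (a : Fin 5 → ℝ) : H := ∑ i, ((a i : ℝ) : ℂ) • e i

variable (e : Fin 5 → H)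

/-- `y`. [cite: Enflo2023, v2 p.13, eq. (27)] -/
def y : H := vec e yc

/-- `u = x₀ − y`. [cite: Enflo2023, v2 p.13, eq. (27)] -/
def u (et : ℝ) : H := vec e (uc et)

/-- `x₀`. [cite: Enflo2023, v2 p.13, eq. (27)] -/
def x0 (et : ℝ) : H := vec e (x0c et)

variable {e}

/-- `vec` is additive. [folklore] -/
lemma vec_add (a b : Fin 5 → ℝ) : vec e (fun i => a i + b i) = vec e a + vec e b := by
  unfold vec; rw [← Finset.sum_add_distrib]; congr 1; funext i; push_cast; rw [add_smul]

/-- `vec` respects subtraction. [folklore] -/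
lemma vec_sub (a b : Fin 5 → ℝ) : vec e (fun i => a i - b i) = vec e a - vec e b := by
  unfold vec; rw [← Finset.sum_sub_distrib]; congr 1; funext i; push_cast; rw [sub_smul]

/-- `vec` respects real scalars. [folklore] -/
lemma vec_smul (t : ℝ) (a : Fin 5 → ℝ) : vec e (fun i => t * a i) = ((t : ℝ) : ℂ) • vec e a := by
  unfold vec; rw [Finset.smul_sum]; congr 1; funext i; push_cast; rw [smul_smul]

/-- `x₀ = y + u`. [cite: Enflo2023, v2 p.13, eq. (27)] -/
lemma x0_eq (et : ℝ) : x0 e et = y e + u e et := by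
  unfold x0 y u; rw [← vec_add]; congr 1; funext i; exact x0c_eq et i

/-- `x₀ − y = u`. [cite: Enflo2023, v2 p.13, eq. (27)] -/
lemma x0_sub_y (et : ℝ) : x0 e et - y e = u e et := by
  rw [x0_eq, add_sub_cancel_left]

/-- An operator with `T eᵢ = μᵢ eᵢ` acts diagonally on real combinations of the frame. [folklore] -/
lemma T_vec {T : H →L[ℂ] H} (hTe : ∀ i, T (e i) = ((mu i : ℝ) : ℂ) • e i) (a : Fin 5 → ℝ) :
    T (vec e a) = vec e (fun i => mu i * a i) := by
  unfold vec
  rw [map_sum]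
  refine Finset.sum_congr rfl (fun i _ => ?_)
  rw [map_smul, hTe i, smul_smul]
  push_cast
  rw [mul_comm]

/-- Hence every power: `T^j (Σ aᵢeᵢ) = Σ μᵢ^j aᵢ eᵢ`. [folklore] -/
lemma T_pow_vec {T : H →L[ℂ] H} (hTe : ∀ i, T (e i) = ((mu i : ℝ) : ℂ) • e i) (j : ℕ) (a : Fin 5 → ℝ) :
    (T ^ j) (vec e a) = vec e (fun i => mu i ^ j * a i) := by
  induction j generalizing a with
  | zero => simp
  | succ j ih =>
    rw [pow_succ]
    change (T ^ j) (T (vec e a)) = _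
    rw [T_vec hTe, ih]
    congr 1; funext i; ring

section frame

variable (he : Orthonormal ℂ e)
include he

/-- Inner products of real combinations of an orthonormal frame. [folklore] -/
lemma inner_vec (a b : Fin 5 → ℝ) : ⟪vec e a, vec e b⟫_ℂ = ((∑ i, a i * b i : ℝ) : ℂ) := by
  unfold vec
  rw [he.inner_sum]
  push_cast
  refine Finset.sum_congr rfl (fun i _ => ?_)
  rw [Complex.conj_ofReal]

/-- Norms of real combinations of an orthonormal frame. [folklore] -/
lemma norm_sq_vec (a : Fin 5 → ℝ) : ‖vec e a‖ ^ 2 = ∑ i, a i ^ 2 := by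
  have h := inner_vec he a a
  rw [inner_self_eq_coe_norm_sq] at h
  rw [Complex.ofReal_injective h]
  exact Finset.sum_congr rfl (fun i _ => by ring)

/-- `⟨e₀, Σ aᵢeᵢ⟩ = a₀`. [folklore] -/
lemma inner_e0_vec (a : Fin 5 → ℝ) : ⟪e 0, vec e a⟫_ℂ = ((a 0 : ℝ) : ℂ) := by
  unfold vec; rw [he.inner_right_fintype]

/-- `‖y‖² = 43/50`. [cite: Enflo2023, v2 p.13, eq. (27)] -/
lemma norm_sq_y : ‖y e‖ ^ 2 = 43 / 50 := by
  unfold y; rw [norm_sq_vec he]; simp [Fin.sum_univ_five, yc]; norm_num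

/-- `‖y‖ ≤ 1`. [cite: Enflo2023, v2 p.13, eq. (27)] -/
lemma norm_y_le_one : ‖y e‖ ≤ 1 := by
  have h : ‖y e‖ ^ 2 ≤ 1 := by rw [norm_sq_y he]; norm_num
  exact (pow_le_one_iff_of_nonneg (norm_nonneg _) two_ne_zero).1 h

/-- `y ≠ 0`. [cite: Enflo2023, v2 p.13, eq. (27)] -/
lemma y_ne_zero : y e ≠ 0 := by
  intro h; have := norm_sq_y he; rw [h, norm_zero] at this; norm_num at this

/-- `⟨e₀, y⟩ = 3/5`. [cite: Enflo2023, v2 p.13, eq. (27)] -/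
lemma inner_e0_y : ⟪e 0, y e⟫_ℂ = ((3 / 5 : ℝ) : ℂ) := by
  unfold y; rw [inner_e0_vec he]; simp [yc]

/-- `y` lies in the Type-1 cone of `u₀ = e₀`: `Re⟨e₀, y⟩ = 3/5 ≥ ‖y‖/100`. [cite: Enflo2023, v2 p.6] -/
lemma angleCond_y : Referee.AngleCond (e 0) (y e) := by
  refine ⟨y_ne_zero he, ?_⟩
  rw [inner_e0_y he, Complex.ofReal_re]
  have := norm_y_le_one he
  linarith

/-- `⟨y, x₀ − y⟩ = ⟨y, u⟩ = εθ` (the Lagrange weights sum to `1`). [cite: Enflo2023, v2 p.13, eq. (26)] -/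
lemma inner_u_y (et : ℝ) : ⟪u e et, y e⟫_ℂ = ((et : ℝ) : ℂ) := by
  unfold u y; rw [inner_vec he]; congr 1; simp [Fin.sum_univ_five, yc, uc]; ring

/-- `‖x₀ − y‖² = ‖u‖² = 7/50 − 2εθ`. [cite: Enflo2023, v2 p.13, eq. (26)] -/
lemma norm_sq_u {et : ℝ} (het0 : 0 < et) (het2 : et ≤ 1 / 10 ^ 23) : ‖u e et‖ ^ 2 = 7 / 50 - 2 * et := by
  unfold u; rw [norm_sq_vec he]; simp [Fin.sum_univ_five, uc]; rw [s_sq het0 het2, radicand_eq]; ring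

/-- `‖x₀‖² = 1`. [cite: Enflo2023, v2 p.13, eq. (26)] -/
lemma norm_sq_x0 {et : ℝ} (het0 : 0 < et) (het2 : et ≤ 1 / 10 ^ 23) : ‖x0 e et‖ ^ 2 = 1 := by
  unfold x0; rw [norm_sq_vec he]; simp [Fin.sum_univ_five, x0c]; rw [s_sq het0 het2]; unfold radicand; ring

/-- `‖x₀‖ = 1`. [cite: Enflo2023, v2 p.13, eq. (26)] -/
lemma norm_x0 {et : ℝ} (het0 : 0 < et) (het2 : et ≤ 1 / 10 ^ 23) : ‖x0 e et‖ = 1 := by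
  have h := norm_sq_x0 he het0 het2
  have h0 : 0 ≤ ‖x0 e et‖ := norm_nonneg _
  nlinarith

/-- `⟨y, x₀ − y⟩ = εθ`. [cite: Enflo2023, v2 p.13, eq. (26)] -/
lemma inner_x0_sub_y_y (et : ℝ) : ⟪x0 e et - y e, y e⟫_ℂ = ((et : ℝ) : ℂ) := by
  rw [x0_sub_y, inner_u_y he]

/-- The distance window: `0.3 ≤ ‖x₀ − y‖ ≤ 0.5` (`‖x₀ − y‖ ≈ 0.374`, inside Lemma 1's `(0.3, 0.5]` and the
`[0.3, 0.7]` of `eq27_false_for_minimal`). [cite: Enflo2023, v2 p.10, Lemma 1] -/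
lemma window {et : ℝ} (het0 : 0 < et) (het2 : et ≤ 1 / 10 ^ 23) :
    (0.3 : ℝ) ≤ ‖x0 e et - y e‖ ∧ ‖x0 e et - y e‖ ≤ 0.5 := by
  rw [x0_sub_y]
  have h := norm_sq_u he het0 het2
  have h0 : 0 ≤ ‖u e et‖ := norm_nonneg _
  constructor <;> nlinarith

/-- `⟨y, Ty⟩ = (236/525)λ`. [cite: Enflo2023, v2 p.13, eq. (27)] -/
lemma inner_y_Ty {T : H →L[ℂ] H} (hTe : ∀ i, T (e i) = ((mu i : ℝ) : ℂ) • e i) :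
    ⟪y e, T (y e)⟫_ℂ = ((236 / 525 * lam : ℝ) : ℂ) := by
  unfold y; rw [T_vec hTe, inner_vec he]; congr 1; simp [Fin.sum_univ_five, yc, mu]; ring

/-- The generic-position bound `|⟨y, Ty⟩| ≥ 10⁻²¹` (`= 4.5·10⁻²¹`). [cite: Enflo2023, v2 p.13, eq. (27)] -/
lemma kappa {T : H →L[ℂ] H} (hTe : ∀ i, T (e i) = ((mu i : ℝ) : ℂ) • e i) :
    1 / 10 ^ 21 ≤ ‖⟪y e, T (y e)⟫_ℂ‖ := by
  rw [inner_y_Ty he hTe, Complex.norm_real, Real.norm_of_nonneg (by rw [lam_def]; norm_num), lam_def]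
  norm_num

/-- `Ty − (⟨y,Ty⟩/‖y‖²)y` in coordinates: `Σ λyᵢ(rᵢ − 472/903)eᵢ`. [cite: Enflo2023, v2 p.13, eq. (27)] -/
lemma Ty_sub_proj {T : H →L[ℂ] H} (hTe : ∀ i, T (e i) = ((mu i : ℝ) : ℂ) • e i) :
    T (y e) - (⟪y e, T (y e)⟫_ℂ / ((‖y e‖ ^ 2 : ℝ) : ℂ)) • y e
      = vec e (fun i => mu i * yc i - (236 / 525 * lam / (43 / 50)) * yc i) := by
  rw [inner_y_Ty he hTe, norm_sq_y he, ← Complex.ofReal_div, vec_sub, vec_smul]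
  unfold y; rw [T_vec hTe]

/-- The generic-position bound `dist(Ty, ℂy) ≥ 10⁻²¹` (`= 0.376·10⁻²⁰`). [cite: Enflo2023, v2 p.13, eq. (27)] -/
lemma tau {T : H →L[ℂ] H} (hTe : ∀ i, T (e i) = ((mu i : ℝ) : ℂ) • e i) :
    1 / 10 ^ 21 ≤ ‖T (y e) - (⟪y e, T (y e)⟫_ℂ / ((‖y e‖ ^ 2 : ℝ) : ℂ)) • y e‖ := by
  rw [Ty_sub_proj he hTe]
  have h : (1 / 10 ^ 21 : ℝ) ^ 2
      ≤ ‖vec e (fun i => mu i * yc i - (236 / 525 * lam / (43 / 50)) * yc i)‖ ^ 2 := by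
    rw [norm_sq_vec he]; simp [Fin.sum_univ_five, yc, mu, lam_def]; norm_num
  exact (pow_le_pow_iff_left₀ (by norm_num) (norm_nonneg _) two_ne_zero).1 h

/-- Case II in coordinates: `⟨T^j y, x₀ − y⟩ = εθ·(−λ^j/120 + (125/8)(λ/5)^j − (216/5)(λ/6)^j + (343/12)(λ/7)^j)`.
[cite: Enflo2023, v2 p.13, Case II] -/
lemma inner_u_Tpow_y {T : H →L[ℂ] H} (hTe : ∀ i, T (e i) = ((mu i : ℝ) : ℂ) • e i) (et : ℝ) (j : ℕ) :
    ⟪u e et, (T ^ j) (y e)⟫_ℂ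
      = ((et * (-(1 / 120) * lam ^ j + 125 / 8 * (lam / 5) ^ j - 216 / 5 * (lam / 6) ^ j
          + 343 / 12 * (lam / 7) ^ j) : ℝ) : ℂ) := by
  unfold u y; rw [T_pow_vec hTe, inner_vec he]; congr 1; simp [Fin.sum_univ_five, yc, uc, mu]; ring

/-- **Case II holds for EVERY `j ≥ 1`, strictly**: `|⟨T^j y, x₀ − y⟩| < (εθ)⁴` — it is `0` for `j ≤ 3` and
`≤ (1049/12)·10⁻⁸⁰·εθ` for `j ≥ 4` (this is where `εθ ≥ 10⁻²⁶` is used). [cite: Enflo2023, v2 p.13, Case II] -/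
lemma caseII_all {T : H →L[ℂ] H} (hTe : ∀ i, T (e i) = ((mu i : ℝ) : ℂ) • e i) {et : ℝ}
    (het1 : 1 / 10 ^ 26 ≤ et) (j : ℕ) (hj : 1 ≤ j) :
    ‖⟪x0 e et - y e, (T ^ j) (y e)⟫_ℂ‖ < et ^ 4 := by
  have het0 : 0 < et := lt_of_lt_of_le (by norm_num) het1
  rw [x0_sub_y, inner_u_Tpow_y he hTe, Complex.norm_real, Real.norm_eq_abs, abs_mul, abs_of_pos het0]
  by_cases h3 : j ≤ 3
  · rw [bracket_zero_of_le_three j hj h3, abs_zero, mul_zero]; positivity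
  · push Not at h3
    have hb := bracket_abs_le j h3
    have h3' : (1 / 10 ^ 26 : ℝ) ^ 3 ≤ et ^ 3 := pow_le_pow_left₀ (by norm_num) het1 3
    have hlt : 1049 / 12 * lam ^ 4 < et ^ 3 := lt_of_lt_of_le (by rw [lam_def]; norm_num) h3'
    calc et * |(-(1 / 120) * lam ^ j + 125 / 8 * (lam / 5) ^ j - 216 / 5 * (lam / 6) ^ j
            + 343 / 12 * (lam / 7) ^ j : ℝ)| ≤ et * (1049 / 12 * lam ^ 4) :=
          mul_le_mul_of_nonneg_left hb het0.le
      _ < et * et ^ 3 := mul_lt_mul_of_pos_left hlt het0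
      _ = et ^ 4 := by ring

/-- Case II at `j = 1`, in the form `eq27_false_for_minimal` takes it. [cite: Enflo2023, v2 p.13, Case II] -/
lemma caseII_one {T : H →L[ℂ] H} (hTe : ∀ i, T (e i) = ((mu i : ℝ) : ℂ) • e i) {et : ℝ}
    (het1 : 1 / 10 ^ 26 ≤ et) : ‖⟪x0 e et - y e, T (y e)⟫_ℂ‖ ≤ et ^ 4 := by
  have h := caseII_all he hTe het1 1 le_rfl
  rw [pow_one] at h
  exact h.le

/-- The radius of (26): `ε' = ‖x₀ − (1+δ)y‖ < 1` (`≤ 0.5 + δ‖y‖`). [cite: Enflo2023, v2 p.13, eq. (26)] -/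
lemma radius_lt_one {et : ℝ} (het0 : 0 < et) (het2 : et ≤ 1 / 10 ^ 23) :
    ‖x0 e et - ((1 + et / 10 : ℝ) : ℂ) • y e‖ < 1 := by
  have hyle := norm_y_le_one he
  obtain ⟨-, hρ2⟩ := window he het0 het2
  have hsplit : x0 e et - ((1 + et / 10 : ℝ) : ℂ) • y e = (x0 e et - y e) - ((et / 10 : ℝ) : ℂ) • y e := by
    push_cast
    rw [add_smul, one_smul]
    abel
  rw [hsplit]
  calc ‖(x0 e et - y e) - ((et / 10 : ℝ) : ℂ) • y e‖ ≤ ‖x0 e et - y e‖ + ‖((et / 10 : ℝ) : ℂ) • y e‖ :=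
        norm_sub_le _ _
    _ ≤ 0.5 + et / 10 * 1 := by
        rw [norm_smul, Complex.norm_real, Real.norm_of_nonneg (by linarith)]
        gcongr
    _ < 1 := by linarith

variable [CompleteSpace H]

/-- **Problem (26) has a minimal solution, and (27) fails for it.**  For any `T` with `T eᵢ = μᵢ eᵢ` on the frame,
`‖T‖ ≤ 10⁻²⁰`, and every `εθ ∈ [10⁻²⁶, 10⁻²³]`: problem (1) for `V_y` at `ε' = ‖x₀ − (1+δ)y‖` has a norm-minimal
solution `a ∈ ℓ²` (`(1+δ)e₀` is feasible, `ℓ²` complete), and its move is `≥ (εθ)²` (`eq27_false_for_minimal`).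
[cite: Enflo2023, v2 p.13, eq. (26)–(27)] -/
theorem exists_minimal_and_eq27_false {T : H →L[ℂ] H} (hTe : ∀ i, T (e i) = ((mu i : ℝ) : ℂ) • e i)
    (hT1 : ‖T‖ < 1) (hT : ‖T‖ ≤ 1 / 10 ^ 20) {et : ℝ} (het1 : 1 / 10 ^ 26 ≤ et) (het2 : et ≤ 1 / 10 ^ 23) :
    ∃ a : Vy.ℓ2,
      IsMinimal (Vy.V T hT1 (y e)) (x0 e et) ‖x0 e et - ((1 + et / 10 : ℝ) : ℂ) • y e‖ a ∧
      et ^ 2 ≤ ‖Vy.V T hT1 (y e) a - ((1 + et / 10 : ℝ) : ℂ) • y e‖ := by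
  have het0 : 0 < et := lt_of_lt_of_le (by norm_num) het1
  have hfeas : ((((1 + et / 10 : ℝ) : ℂ)) • (lp.single 2 0 (1 : ℂ) : Vy.ℓ2)) ∈
      feasible (Vy.V T hT1 (y e)) (x0 e et) ‖x0 e et - ((1 + et / 10 : ℝ) : ℂ) • y e‖ := by
    rw [mem_feasible, Vy.V_smul_single_zero]
  obtain ⟨a, ha⟩ := exists_isMinimal _ _ _ ⟨_, hfeas⟩
  obtain ⟨hρ1, hρ2⟩ := window he het0 het2
  exact ⟨a, ha, eq27_false_for_minimal T hT1 hT (x0 e et) (y e) et _ a (norm_x0 he het0 het2)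
    (inner_x0_sub_y_y he et) (het1.trans' (by norm_num)) het2 hρ1 (hρ2.trans (by norm_num))
    (caseII_one he hTe het1) (kappa he hTe) (tau he hTe) ha (radius_lt_one he het0 het2) le_rfl⟩

end frame

end WindowModelT

/-! ### (3) The instantiation on `ℓ²(ℕ)`: formaliser 2's diagonal `D`, frame `e₀, e₄, e₅, e₆, e₁` -/

namespace ModelT

open RoomModelT (ℓ2T D dW D_apply dW_pos dW_le D_injective D_not_surjective D_denseRange D_isSelfAdjoint
  zero_mem_spectrum_D norm_D)

/-- The indices of the frame inside `ℓ²(ℕ)`: eigenvalue `10⁻²⁰` at `0` and `1`, `10⁻²⁰/(k+1)` at `k = 4, 5, 6`. [folklore] -/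
def idx : Fin 5 → ℕ := ![0, 4, 5, 6, 1]

/-- The frame: standard unit vectors of `ℓ²(ℕ)` at the indices `0, 4, 5, 6, 1`. [folklore] -/
def eS (i : Fin 5) : ℓ2T := lp.single 2 (idx i) (1 : ℂ)

/-- The frame is orthonormal (the indices `0, 4, 5, 6, 1` are distinct). [folklore] -/
lemma orthonormal_eS : Orthonormal ℂ eS := by
  classical
  have hinj : Function.Injective idx := by decide
  rw [orthonormal_iff_ite]
  intro i j
  unfold eS
  rw [lp.inner_single_left, lp.single_apply]
  by_cases h : i = j
  · subst h; simp
  · have hij : idx i ≠ idx j := fun hh => h (hinj hh)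
    rw [Pi.single_eq_of_ne hij]; simp [h]

/-- `D e_k = dW_k e_k` for every standard unit vector. [folklore] -/
lemma D_single (k : ℕ) : D (lp.single 2 k (1 : ℂ)) = ((dW k : ℝ) : ℂ) • lp.single 2 k (1 : ℂ) := by
  apply lp.ext
  funext m
  rw [lp.coeFn_smul, Pi.smul_apply, D_apply, smul_eq_mul, lp.single_apply]
  by_cases hm : m = k
  · rw [hm, Pi.single_eq_same]
  · rw [Pi.single_eq_of_ne hm, mul_zero, mul_zero]

/-- The weights at the frame indices are the model eigenvalues `λ(1, 1/5, 1/6, 1/7, 1)`. [folklore] -/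
lemma dW_idx (i : Fin 5) : dW (idx i) = WindowModelT.mu i := by
  fin_cases i <;> simp [idx, dW, WindowModelT.mu, WindowModelT.lam_def] <;> norm_num

/-- `D` acts on the frame with the model eigenvalues. [folklore] -/
lemma D_eS (i : Fin 5) : D (eS i) = ((WindowModelT.mu i : ℝ) : ℂ) • eS i := by
  unfold eS; rw [D_single, dW_idx]

/-- `‖D‖ = 10⁻²⁰` in the notation of `CaseII.lean`. [folklore] -/
lemma norm_D_eq : ‖D‖ = 1 / 10 ^ 20 := by rw [norm_D]; norm_num

/-- `‖D‖ ≤ 10⁻²⁰`. [folklore] -/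
lemma norm_D_le : ‖D‖ ≤ 1 / 10 ^ 20 := norm_D_eq.le

/-- `‖D‖ < 1`. [folklore] -/
lemma norm_D_lt_one : ‖D‖ < 1 := by rw [norm_D_eq]; norm_num

/-- `ℓ²(ℕ)` is separable (the finitely supported vectors with coefficient span dense). [folklore] -/
theorem separableSpace_ℓ2T : TopologicalSpace.SeparableSpace ℓ2T := by
  classical
  let S : Set ℓ2T := Set.range (fun k : ℕ => (lp.single 2 k (1 : ℂ) : ℓ2T))
  have hS : TopologicalSpace.IsSeparable (closure (Submodule.span ℂ S : Set ℓ2T)) :=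
    ((Set.countable_range _).isSeparable.span).closure
  have huniv : (Set.univ : Set ℓ2T) ⊆ closure (Submodule.span ℂ S : Set ℓ2T) := by
    intro f _
    have h := (lp.hasSum_single (by simp) f).tendsto_sum_nat
    refine mem_closure_of_tendsto h (Filter.Eventually.of_forall (fun n => ?_))
    refine Submodule.sum_mem _ (fun k _ => ?_)
    have hk : (lp.single 2 k (f k) : ℓ2T) = (f k) • lp.single 2 k (1 : ℂ) := by
      rw [← lp.single_smul, smul_eq_mul, mul_one]
    rw [hk]
    exact Submodule.smul_mem _ _ (Submodule.subset_span ⟨k, rfl⟩)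
  exact TopologicalSpace.isSeparable_univ_iff.mp (hS.mono huniv)

/-- `ℓ²(ℕ)` is infinite-dimensional (`D` is injective but not surjective). [folklore] -/
theorem not_finiteDimensional_ℓ2T : ¬ FiniteDimensional ℂ ℓ2T := by
  intro hfd
  apply D_not_surjective
  have h := LinearMap.surjective_of_injective (f := (D : ℓ2T →ₗ[ℂ] ℓ2T)) (by exact D_injective)
  exact h

/-- Coordinates of the iterates: `(D^n f)_k = dW_k^n f_k`. [folklore] -/
lemma D_iterate_apply (n : ℕ) (f : ℓ2T) (k : ℕ) : ((⇑D)^[n] f) k = ((dW k : ℝ) : ℂ) ^ n * f k := by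
  induction n with
  | zero => simp
  | succ n ih => rw [Function.iterate_succ_apply', D_apply, ih]; ring

/-- The terms `dW_k^n |f_k|²` are summable. [folklore] -/
lemma summable_dW_pow_mul_sq (n : ℕ) (f : ℓ2T) : Summable (fun k => dW k ^ n * ‖f k‖ ^ 2) := by
  refine Summable.of_nonneg_of_le (fun k => by have := dW_pos k; positivity) (fun k => ?_)
    (RoomModelT.summable_sq f)
  have h1 : dW k ^ n ≤ 1 := pow_le_one₀ (dW_pos k).le ((dW_le k).trans (by norm_num))
  have h2 : 0 ≤ ‖f k‖ ^ 2 := by positivity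
  nlinarith

/-- `⟨D^n f, f⟩ = Σ_k dW_k^n |f_k|²` (real, non-negative). [folklore] -/
lemma inner_D_iterate (n : ℕ) (f : ℓ2T) :
    ⟪(⇑D)^[n] f, f⟫_ℂ = ((∑' k, dW k ^ n * ‖f k‖ ^ 2 : ℝ) : ℂ) := by
  rw [lp.inner_eq_tsum, Complex.ofReal_tsum]
  congr 1
  funext k
  rw [D_iterate_apply, RCLike.inner_apply', map_mul, map_pow, Complex.conj_ofReal, mul_assoc,
    Complex.conj_mul']
  push_cast
  ring

/-- **`D` is of Type 1 via `u₀ = e₀`**, with `δ_n = 10^{-20n}/10⁴` and `j = n`: for `f` in the cone,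
`Re f₀ ≥ ‖f‖/100`, so `⟨D^n f, f⟩ ≥ dW₀^n |f₀|² ≥ 10^{-20n}‖f‖²/10⁴`. [cite: Enflo2023, v2 p.6] -/
theorem D_type1_via_e0 (n : ℕ) (_hn : 1 ≤ n) : ∃ δ : ℝ, 0 < δ ∧ ∀ f : ℓ2T, Referee.AngleCond (eS 0) f →
    ∃ j : ℕ, n ≤ j ∧ δ * ‖f‖ ^ 2 ≤ ‖⟪(⇑D)^[j] f, f⟫_ℂ‖ := by
  refine ⟨(1e-20) ^ n / 10 ^ 4, by positivity, fun f hf => ⟨n, le_rfl, ?_⟩⟩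
  obtain ⟨-, hang⟩ := hf
  have h1 : (⟪eS 0, f⟫_ℂ).re = (f 0).re := by
    unfold eS
    rw [lp.inner_single_left, RCLike.inner_apply', map_one, one_mul]
    simp [idx]
  rw [h1] at hang
  have hs := summable_dW_pow_mul_sq n f
  have h2 : dW 0 ^ n * ‖f 0‖ ^ 2 ≤ ∑' k, dW k ^ n * ‖f k‖ ^ 2 :=
    hs.le_tsum 0 (fun k _ => by have := dW_pos k; positivity)
  have h0 : dW 0 = 1e-20 := RoomModelT.dW_of_lt (by norm_num)
  rw [h0] at h2
  rw [inner_D_iterate, Complex.norm_real, Real.norm_of_nonneg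
    (tsum_nonneg (fun k => by have := dW_pos k; positivity))]
  have h3 : |(f 0).re| ≤ ‖f 0‖ := Complex.abs_re_le_norm _
  have h4 : (1 / 100 : ℝ) * ‖f‖ ≤ ‖f 0‖ := hang.trans ((le_abs_self _).trans h3)
  have h5 : ((1 / 100 : ℝ) * ‖f‖) ^ 2 ≤ ‖f 0‖ ^ 2 := pow_le_pow_left₀ (by positivity) h4 2
  have h6 : (0 : ℝ) ≤ (1e-20) ^ n := by positivity
  calc (1e-20 : ℝ) ^ n / 10 ^ 4 * ‖f‖ ^ 2 = (1e-20) ^ n * ((1 / 100 : ℝ) * ‖f‖) ^ 2 := by ring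
    _ ≤ (1e-20) ^ n * ‖f 0‖ ^ 2 := mul_le_mul_of_nonneg_left h5 h6
    _ ≤ ∑' k, dW k ^ n * ‖f k‖ ^ 2 := h2

/-- `D` is of Type 1 (v2 p.6). [cite: Enflo2023, v2 p.6] -/
theorem D_type1 : Referee.Type1 D :=
  ⟨eS 0, orthonormal_eS.1 0, D_type1_via_e0⟩

open WindowModelT (x0 y)

/-- **The `ℓ²(ℕ)` model at parameter `εθ ∈ [10⁻²⁶, 10⁻²³]`**: problem (26) for `V_y` (operator `D`) has a minimal
solution `a`; every hypothesis of `Eq27InferenceSA` about the data holds (with the tighter window `≤ 0.5` and Case II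
for all `j ≥ 1`); the generic-position bounds of `eq27_false_for_minimal` hold; and the minimal move is `≥ (εθ)²`.
[cite: Enflo2023, v2 p.13, eq. (26)–(27)] -/
theorem facts {et : ℝ} (het1 : 1 / 10 ^ 26 ≤ et) (het2 : et ≤ 1 / 10 ^ 23) :
    ∃ a : Vy.ℓ2,
      IsMinimal (Vy.V D norm_D_lt_one (y eS)) (x0 eS et) ‖x0 eS et - ((1 + et / 10 : ℝ) : ℂ) • y eS‖ a ∧
      ‖x0 eS et‖ = 1 ∧ ⟪x0 eS et - y eS, y eS⟫_ℂ = (et : ℂ) ∧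
      ((0.3 : ℝ) ≤ ‖x0 eS et - y eS‖ ∧ ‖x0 eS et - y eS‖ ≤ 0.5) ∧
      (∀ j : ℕ, 1 ≤ j → ‖⟪x0 eS et - y eS, (D ^ j) (y eS)⟫_ℂ‖ < et ^ 4) ∧
      1 / 10 ^ 21 ≤ ‖⟪y eS, D (y eS)⟫_ℂ‖ ∧
      1 / 10 ^ 21 ≤ ‖D (y eS) - (⟪y eS, D (y eS)⟫_ℂ / ((‖y eS‖ ^ 2 : ℝ) : ℂ)) • y eS‖ ∧
      ‖x0 eS et - ((1 + et / 10 : ℝ) : ℂ) • y eS‖ < 1 ∧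
      Referee.AngleCond (eS 0) (y eS) ∧
      et ^ 2 ≤ ‖Vy.V D norm_D_lt_one (y eS) a - ((1 + et / 10 : ℝ) : ℂ) • y eS‖ := by
  have he := orthonormal_eS
  have het0 : 0 < et := lt_of_lt_of_le (by norm_num) het1
  obtain ⟨a, ha, hmove⟩ :=
    WindowModelT.exists_minimal_and_eq27_false he D_eS norm_D_lt_one norm_D_le het1 het2
  exact ⟨a, ha, WindowModelT.norm_x0 he het0 het2, WindowModelT.inner_x0_sub_y_y he et,
    WindowModelT.window he het0 het2, WindowModelT.caseII_all he D_eS het1, WindowModelT.kappa he D_eS,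
    WindowModelT.tau he D_eS, WindowModelT.radius_lt_one he het0 het2, WindowModelT.angleCond_y he, hmove⟩

end ModelT

open RoomModelT (ℓ2T D D_injective D_not_surjective D_denseRange D_isSelfAdjoint zero_mem_spectrum_D)

/-- **Satisfiability on `ℓ²(ℕ)` with every standing hypothesis, and the refutation firing.**  For every
`εθ ∈ [10⁻²⁶, 10⁻²³]` there are, on the separable infinite-dimensional Hilbert space `ℓ²(ℕ)`, a SELF-ADJOINT,
injective, non-surjective, dense-range operator `T` with `0 ∈ σ(T)`, `‖T‖ = 10⁻²⁰`, of Type 1 via a unit vector `u₀`,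
and vectors `x₀, y` with `y` in the Type-1 cone of `u₀`, `‖x₀‖ = 1`, `⟨y, x₀ − y⟩ = εθ`, `0.3 ≤ ‖x₀ − y‖ ≤ 0.5`,
Case II for ALL `j ≥ 1` strictly, the generic-position bounds, and THE norm-minimal solution `a` of (26) — whose move
is `≥ (εθ)²`, i.e. (27) fails. [cite: Enflo2023, v2 p.13, eq. (26)–(27); pp.1–2; p.6] -/
theorem minimal_window_satisfiable_T {et : ℝ} (het1 : 1 / 10 ^ 26 ≤ et) (het2 : et ≤ 1 / 10 ^ 23) :
    ∃ (T : ℓ2T →L[ℂ] ℓ2T) (hT1 : ‖T‖ < 1) (u₀ x₀ y : ℓ2T) (a : Vy.ℓ2),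
      IsSelfAdjoint T ∧ Function.Injective T ∧ ¬ Function.Surjective T ∧ DenseRange T ∧
      (0 : ℂ) ∈ spectrum ℂ T ∧ ‖T‖ = 1 / 10 ^ 20 ∧ ‖u₀‖ = 1 ∧
      (∀ n : ℕ, 1 ≤ n → ∃ δ : ℝ, 0 < δ ∧ ∀ y' : ℓ2T, Referee.AngleCond u₀ y' →
          ∃ j : ℕ, n ≤ j ∧ δ * ‖y'‖ ^ 2 ≤ ‖⟪(⇑T)^[j] y', y'⟫_ℂ‖) ∧
      Referee.AngleCond u₀ y ∧
      ‖x₀‖ = 1 ∧ ⟪x₀ - y, y⟫_ℂ = (et : ℂ) ∧ ((0.3 : ℝ) ≤ ‖x₀ - y‖ ∧ ‖x₀ - y‖ ≤ 0.5) ∧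
      (∀ j : ℕ, 1 ≤ j → ‖⟪x₀ - y, (T ^ j) y⟫_ℂ‖ < et ^ 4) ∧
      1 / 10 ^ 21 ≤ ‖⟪y, T y⟫_ℂ‖ ∧ 1 / 10 ^ 21 ≤ ‖T y - (⟪y, T y⟫_ℂ / ((‖y‖ ^ 2 : ℝ) : ℂ)) • y‖ ∧
      IsMinimal (Vy.V T hT1 y) x₀ ‖x₀ - ((1 + et / 10 : ℝ) : ℂ) • y‖ a ∧
      ‖x₀ - ((1 + et / 10 : ℝ) : ℂ) • y‖ < 1 ∧
      et ^ 2 ≤ ‖Vy.V T hT1 y a - ((1 + et / 10 : ℝ) : ℂ) • y‖ := by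
  obtain ⟨a, ha, h0, hey, hρ, hcase, hκ, hτ, hrad, hang, hmove⟩ := ModelT.facts het1 het2
  exact ⟨D, ModelT.norm_D_lt_one, ModelT.eS 0, WindowModelT.x0 ModelT.eS et,
    WindowModelT.y ModelT.eS, a, D_isSelfAdjoint, D_injective, D_not_surjective, D_denseRange,
    zero_mem_spectrum_D, ModelT.norm_D_eq, ModelT.orthonormal_eS.1 0, ModelT.D_type1_via_e0,
    hang, h0, hey, hρ, hcase, hκ, hτ, ha, hrad, hmove⟩

end CaseII

/-! ### (4) Verdicts -/

/-- **Lean refuses the p.13 inference (26) ⟹ (27) even with the operator and ALL its standing hypotheses in it,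
`T` self-adjoint and of Type 1 included.**  Witness: `ℓ²(ℕ)`, `T = D`, `εθ = 10⁻²⁴`, and THE minimiser of (26),
whose move is `≥ (εθ)²` by `CaseII.eq27_false_for_minimal`. [cite: Enflo2023, v2 p.13, eq. (27)] -/
theorem not_eq27InferenceSA : ¬ Eq27InferenceSA := by
  intro h
  haveI := CaseII.ModelT.separableSpace_ℓ2T
  have het1 : (1 / 10 ^ 26 : ℝ) ≤ 1 / 10 ^ 24 := by norm_num
  have het2 : (1 / 10 ^ 24 : ℝ) ≤ 1 / 10 ^ 23 := by norm_num
  obtain ⟨T, hT1, u₀, x₀, y, a, hsa, hinj, hsurj, hdense, hspec, hnorm, hu₀, htype, hang, h0, hey, hρ, hcase,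
    -, -, hmin, -, hmove⟩ := CaseII.minimal_window_satisfiable_T het1 het2
  have hlt := h RoomModelT.ℓ2T CaseII.ModelT.not_finiteDimensional_ℓ2T T hT1 u₀ x₀ y (1 / 10 ^ 24) a hinj hsurj hdense
    hspec hnorm hsa hu₀ htype hang h0 hey (by norm_num) (by norm_num) hρ.1 (hρ.2.trans (by norm_num)) hcase hmin
  exact absurd hlt (not_lt.2 hmove)

/-- Hence the inference with the manuscript's own hypotheses only (no self-adjointness) is refuted too.
[cite: Enflo2023, v2 p.13, eq. (27)] -/
theorem not_eq27Inference : ¬ Eq27Inference :=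
  fun h => not_eq27InferenceSA (eq27InferenceSA_of_eq27Inference h)

end Literature.Analysis.OperatorTheory.Enflo2023

end
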